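import Mathlib
import HarnessLib
import HarnessLib.Audit
import Summits.HodgeConjecture.HodgeConjecture.Theses.NikulinTwinTransport
import Literature.AlgebraicGeometry.Surfaces.K3TwistorLines
import Literature.AlgebraicGeometry.HodgeTheory.HolomorphicBundleChernCharacter
import Summits.HodgeConjecture.HodgeConjecture.Theorems.NikulinTwinTransportTwinSimilitudeAlgebraicTransfer
import Summits.HodgeConjecture.HodgeConjecture.Theorems.TwinTwistorTransport.Negative.NikulinParity
import Summits.HodgeConjecture.HodgeConjecture.Theorems.TwinTwistorTransport.Negative.GenericFirstLine
import Summits.HodgeConjecture.HodgeConjecture.Theorems.TwinTwistorTransport.Negative.AnchorConeCondition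
import Summits.HodgeConjecture.HodgeConjecture.Theorems.TwinTwistorTransport.Negative.PolystableCrossTerm

/-!
# Line `instanton-moduli-trianalytic-twin` — crux `NikulinTwinTransport.TwinTwistorTransport`
# (stmt-HodgeConjecture-14522, route HodgeConjecture/NikulinTwinTransport, rank 4)

Skeleton of the line (crux-plan, planner-cruxplan-stmt-HodgeConjecture-14522-instanton-moduli-tri-0,
2026-08-16), from the crux idea `Cruxes/TwinTwistorTransport/Ideas/instanton-moduli-trianalytic-twin.md`
(triage r1: 3/3 pass, "strongest line" for triager 2, to be merged with
`triholomorphic-classifying-map-transport`) and the panel's sharpenings (TRIAGE-r1-1 K1/K2, TRIAGE-r1-2 §2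
Wirtinger node lemma, TRIAGE-r1-3 F-D/F-E/F-F).

## The crux, typed

The crux was INFORMAL when this seat started (payload `crux.signature = null`; the route file carried
only a comment).  This seat TYPED it (`ledger workitem set-signature stmt-HodgeConjecture-14522`, a
planner act; pre-flighted on a mock of the route file: elaborates, `#h21_route_deps` adds no unproved cone
fact, `#h21_ground` only `ground.skipped` = size over the battery cap, `closes` untouched; the route stayed
READY through revs 5–6) as the DELIVERABLE that the informal clauses (a)+(b)+(c) are meant to produce and
that the tree already consumes:

`TwinTwistorTransport := ∃ M N : End_ℂ(Λ_ℂ), M, N defined over ℚ, M N = N M = 1, (Ma.Mb) = 2(a.b), and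
TWIN TRANSPORT FOR M: for every pair of marked projective K3 surfaces (S, η, p, x), (S′, η′, p′, x′) whose
periods correspond under M (M x′ ∈ ℂx) the twin similitude η⁻¹ ∘ M ∘ η′ : H²(S′(ℂ); ℂ) → H²(S(ℂ); ℂ) is
[γ]_* for an algebraic γ on S × S′`

— verbatim the hypothesis `htw` of the tree theorem
`Theorems.NikulinTwinTransport.twinSimilitudeAlgebraic_of_twinTransport` (file
`NikulinTwinTransportTwinSimilitudeAlgebraicTransfer`, PROVED), with `IsK3Surface` unfolded as in the
route file.  STATE OF THE RENDER (2026-08-16T00:40Z): a first version prefixed by the route items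
`HodgeIsometryAlgebraic → LefschetzOneOneK3 →` made the gate's renderer record
`blocked_missing_decls = [HodgeIsometryAlgebraic, LefschetzOneOneK3]` (the crux is rendered BEFORE those
decls in the route file); the signature was re-set WITHOUT the prefix (Buskin and Lefschetz (1,1) are used
inside the stubs' proofs as the tree's named facts, exactly as the informal crux lists
`HodgeIsometryAlgebraic` among its deps), but the stale block record keeps the item rendered as a
`-- TODO` line until a `route edit --restate TwinTwistorTransport` with the SAME statement (which re-ids
the item — left to the route's planner so as not to re-key the running crux chain).  Hence this file
concludes the LOCAL MIRROR `TwinTwistorTransportTyped` (character for character the recorded signature)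
BY NAME; the switch to `Theses.NikulinTwinTransport.TwinTwistorTransport` is a one-word edit.  The theorem
`twinSimilitudeAlgebraic_of_crux` certifies, kernel-checked, that the typed crux + Buskin (route item r2)
+ the three Huybrechts K3 facts + composition of correspondences (stub E) give the route's target
`TwinSimilitudeAlgebraic` — so a lead who prefers a tree decl as the conclusion can register this
skeleton against the target exactly like the sibling line `semiregular-twin-hodge-locus`.
`M` is existential and only RATIONAL: the completed Nikulin similitude `Ψ = g^* ⊕ (Nⱼ ↦ rⱼ)` is never
integral on the glue (sibling Disproof `Cruxes/NikulinSerreCarrier/Disproof.lean` §A: `2Ψ` integral,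
`m` even), and any single rational 2-similitude suffices for X.

## The line (instanton moduli, trianalytic twin), and its typed shadow

LEVER (card): transport the compact trianalytic IMAGE `F ≅ Y′ ⊂ 𝔐 = M^{lf,st}_X(v)` of the twin in the
moduli of stable bundles on the anchor K3 `X` (Verbitsky's incomplete `L²` hyperkähler structure `ℋ_ω`,
modular twistor fibres `𝔐_ζ = M^{lf,st}_{X_ζ}(v)`), not a sheaf on `X × Y′`: along the twistor line of
`(X, ω)` the transport is definitional, `F` is trianalytic for `ℋ_ω` for EVERY Kähler `ω` in the stability
chamber `C` of `F` (Wirtinger/degree criterion on the compact `F`, TRIAGE-r1-2 §2 / r1-3 F-F: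
`ι_F^*[ω_{2,I}], ι_F^*[ω_{2,J}], ι_F^*[ω_{2,K}] = λΨ⁻¹(ω₂, Re σ, Im σ)` are orthogonal of equal square
because `Ψ⁻¹` is a similitude), and at a PROJECTIVE fibre `X_y` the surface `F_y ⊂ M_{X_y,h}(v)` is
algebraic (Chow on the quasi-projective Gieseker moduli space) with an ALGEBRAIC universal bundle
`𝓔_y` on `X_y × F_y` whose `ch₂` acts on transcendental classes as `λ·(twin similitude)`.

None of `𝔐`, `ℋ_ω`, "trianalytic", Chow-on-moduli has a carrier in `Literature/` today (definition
wants D1–D3 of the card / of grounders g24-13, g25-1: hyperkähler twistor family, `SU(2)`-invariant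
classes + Verbitsky Thm 2.5, analytic/modular Chern classes).  What IS typed: marked projective K3
surfaces and their periods (`K3PeriodSurjectivity`), the period domain and its twistor lines
(`K3TwistorLines`: `k3PeriodDomain`, `k3TwistorLine`, `IsPositiveThreeSpace`; connectivity PROVED),
algebraic classes / correspondences (`complexBetti`, `complexGysin`, `algebraicClasses`), Chern characters
of holomorphic bundles on a Hodge model (`HodgeModel.holomorphicBundleChernCharacter`).  The skeleton is
therefore the PERIOD-DOMAIN SHADOW of the line — what the mechanism outputs at PROJECTIVE fibres — cut
so that every typed step is a genuine lemma and the untyped hyperkähler core is ONE named stub: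

* `AnchoredLineCarriers` (stub A, XL, THE LEVER, blocked on D1–D3 for a formal proof): there are a
  rational 2-similitude pair `(M, N)` and, for every positive lattice vector `h`, an ANCHOR period
  `σ₀ ∈ D` with `(h.σ₀) ≠ 0` and a non-empty OPEN set `C` of Kähler directions `ω ⊥ P_{σ₀}`, `ω² > 0`,
  such that at every PROJECTIVE point `y ⊥ h` of every twistor line `T_{⟨Re σ₀, Im σ₀, ω⟩}`, `ω ∈ C`, the
  K3 at `y` and its `M`-twin carry a holomorphic bundle on their product whose `ch₂` acts on `T(S′)` as
  `λ·(η⁻¹Mη′)` modulo `NS(S)`, `λ ≠ 0` (`BundleCarrierAt`).  Informal proof = the card: `σ₀` = period of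
  a Nikulin K3 `X` generic in a family with `h ∉ NS(X)`, `M` = its completed similitude under markings,
  `F = Y′ ↪ M^{lf,st}_{X,ω}(v)` the modular anchor family (K1 = crux 14464 IN INSTANTON FORM, `v = (r,0,s)`,
  `s ≤ −r`), `C` = the chamber where the points of `F` stay `ω`-stable, trianalytic persistence, Chow.
* `Reach` (stub B, M, PROVABLE NOW — linear algebra in `Λ_ℝ`, = the one-line REACH lemma of TRIAGE-r1-3
  F-E / `IdeatorOneSketch.OneLineReach`): the twistor lines from `σ₀` in the directions of the open set
  `C` meet `D ∩ h^⊥` in the pair `u₀ ± iv`, `u₀ = (Im σ₀.h)Re σ₀ − (Re σ₀.h)Im σ₀`, and the `v` so obtained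
  fill a relatively OPEN non-empty subset of the reach quadric `Q_h(σ₀) = {v ⊥ u₀, v ⊥ h, v² = u₀²}`.
* `Endpoint` (stub C, L): a bundle carrier at `y` gives twin transport at SOME marked pair at `y`
  (`ch₂` of a holomorphic bundle on the projective `S × S′` is algebraic — Voisin I Thm 11.32 = named fact
  `span_holomorphicBundleChernCharacter_eq_algebraicClasses`; the error `[c]_* − λ·twin` is a Hodge
  morphism sending `T(S′)` into `NS(S)`, hence killing `T(S′)` (`T_ℚ` irreducible) and mapping `NS(S′)`
  to `NS(S)`, so it is induced by products of divisors — Lefschetz (1,1) = route item — and `λ ≠ 0`).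
* `Spread` (stub D, L–XL, the SPREAD principle of cards `one-line-totally-real-reach` /
  `one-very-general-endpoint-hecke-spreading`): twin transport on a relatively open subset of the reach
  quadric (both conjugate sheets) spreads to ALL of `D ∩ h^⊥` — `R_h(σ₀) = {u₀ + iv}` is a maximal totally
  real real-analytic submanifold of the polarised period domain `D_h`, the twin-transport locus is a
  countable union of closed analytic subsets (images of relative Hilbert schemes over the Hecke
  correspondence `Γ_h\D_h → Γ_{h′}\D_{h′}`), identity principle + Baire.  Buskin's theorem (named fact
  `Buskin2019_hodgeIsometry_algebraic` = route item r2) and the composition of correspondences (stub E)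
  enter to pass between markings.
* `CorrComp` (stub E, L, formal debt named by the route: Buskin Lemma 6.3 / Fulton Prop 16.1.1):
  composition of algebraic degree-2 correspondences between K3 surfaces is an algebraic correspondence —
  symbol for symbol the hypothesis `hcomp` of `twinSimilitudeAlgebraic_of_twinTransport`.
* `MarkingTransfer` (stub F, M): twin transport at ONE marked pair at `y` gives it at EVERY marked pair
  at `y` (the change of markings is a pair of rational Hodge isometries, algebraic by Buskin; compose).

`TwinTwistorTransport_of` (kernel-checked, no `sorry` outside `namespace Stub`): from the crux's data
`(S, η, p, x)` take `h := u` (the positive lattice vector of `PeriodPt x`); A gives `σ₀, C`; B gives the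
open piece of the reach quadric; A + C give twin transport at one pair at each of its points and their
conjugates; D spreads it to `x ∈ D ∩ h^⊥`; F moves it to the given markings.

## Disproof / negatives honoured (evidence notes of cdisprove gen-1/gen-2 and the four LANDED
## `Theorems/TwinTwistorTransport/Negative/*` lemmas, imported below and checked against)

* `Negative/GenericFirstLine` (`eq_zero_of_oneOne_along_generic_line`, `exists_integral_perp_of_rational_ray`):
  a PRESCRIBED rational first ray has no Pic-trivial node and untwisted transport forces `c₁ = 0` — this
  line prescribes nothing: stub A asks for an OPEN set `C` of directions (Markman Prop 5.19 (i), the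
  disprover's F4/F10 "open subcone is load-bearing"), and carriers of the instanton family have `c₁ = 0`
  on the K3 factor by construction (`v = (r, 0, s)`).
* `Negative/NikulinParity` (`evenEight_ne_nodal_add_two_smul`): the Serre carrier cannot reach `c₁ = 0`
  by nodal modifications — not engaged (no Serre sheaf; the carrier is a family of `c₁ = 0` instantons).
* `Negative/AnchorConeCondition` (`no_minusTwo_class_of_even_degree`): at the anchor the cone condition
  is a genuine condition on the Nikulin family — stub A leaves the anchor EXISTENTIAL (`∃ σ₀` per `h`), so
  its prover chooses an even-degree family where `𝒦 = 𝒞⁺`.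
* `Negative/PolystableCrossTerm` (`finrank_le_of_restrict_eq_smul`): polystable carriers leave an
  untransported cross term — stub A's carriers are slices of ONE stable family (points of `M^{st}`), and
  `BundleCarrierAt` only constrains the action on `T(S′)` modulo `NS(S)`, the cross term being removed
  Hodge-theoretically in stub C.
* cdisprove F5 (refuted strengthening "one twistor line joins two GIVEN points"): never used — stub B only
  claims the points `u₀ ± iv` that a line from `σ₀` DOES reach, stub D does the rest.
* sibling 14464 Disproof §A/§E: `M` rational not integral (built in); admissible slice vectors `s ≤ −r`
  (the card's `v = (2,0,−1)` census is moot — recorded in the line card, not load-bearing here).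
-/

set_option linter.dupNamespace false

noncomputable section

namespace Summit.HodgeConjecture.HodgeConjecture.Cruxes.TwinTwistorTransport.InstantonModuliTrianalyticTwin

open CategoryTheory MonoidalCategory
open scoped Manifold BigOperators
open Literature.AlgebraicGeometry.Motives Literature.AlgebraicGeometry.HodgeTheory
open Literature.AlgebraicGeometry.Surfaces Literature.AlgebraicTopology.SingularHomology
open Literature.Geometry.Kaehler
open Summit.HodgeConjecture.HodgeConjecture.Theses.NikulinTwinTransport

/-! ## Vocabulary (definitions only; the shapes are those of `K3SurfaceProofs` /
`NikulinTwinTransportTwinSimilitudeAlgebraicTransfer`, written as `def`s instead of local notations) -/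

/-- Projective K3 surface: VERBATIM the body of `IsK3Surface` (unfolded exactly as in the route file,
`k3_iff`). -/
def K3 (S : SchemeOver ℂ) : Prop :=
  IsSmoothProjective 2 S ∧ Subsingleton (structureSheafCohomology S.left 1) ∧
    ∃ (A : HodgeModel 2 S) (η : MForm 𝓘(ℝ, A.model) A.carrier ℂ 2),
      IsHolomorphicInCharts η ∧ ∀ x, η x ≠ 0

/-- `K3 S` is `IsK3Surface S`, definitionally. -/
theorem k3_iff (S : SchemeOver ℂ) : K3 S ↔ IsK3Surface S := Iff.rfl

/-- Marked K3 surface with period vector `x` (`η : H²(S(ℂ); ℂ) ≅ Λ_ℂ` identifies integral classes with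
`Λ = ℤ²²` and the cup product with the K3 form times the integral generator `p` of `H⁴`; `η⁻¹ x` is of
type `(2,0)` and spans the `(2,0)`-classes) — the shape `MarkedK3[S, η, p, x]` of the tree. -/
def Marked (S : SchemeOver ℂ) (η : complexBetti S (2 * 1) ≃ₗ[ℂ] (K3Index → ℂ))
    (p : complexBetti S (2 * 2)) (x : K3Index → ℂ) : Prop :=
  IsIntegralClass p ∧
    (∀ q : complexBetti S (2 * 2), IsIntegralClass q → ∃ n : ℤ, q = n • p) ∧
    (∀ c : complexBetti S (2 * 1), IsIntegralClass c ↔ ∃ v : K3Index → ℤ, η c = fun i => (v i : ℂ)) ∧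
    (∀ a b : complexBetti S (2 * 1),
        cupProduct (rfl : 2 * 1 + 2 * 1 = 2 * 2) a b = k3Form (η a) (η b) • p) ∧
    IsOfHodgeType 2 S (2 * 1) 2 0 (η.symm x) ∧
    (∀ τ : complexBetti S (2 * 1), IsOfHodgeType 2 S (2 * 1) 2 0 τ → ∃ t : ℂ, τ = t • η.symm x)

/-- Projective period point: `(x.x) = 0`, `(x̄.x) > 0`, and a positive lattice vector orthogonal to `x`
(the hypotheses of `Huybrechts_K3_periodSurjective_projective`; shape `PeriodPt[x]`). -/
def PeriodPt (x : K3Index → ℂ) : Prop :=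
  k3Form x x = 0 ∧ 0 < (k3Form (star x) x).re ∧
    ∃ u : K3Index → ℤ, k3Form (fun i => (u i : ℂ)) x = 0 ∧ 0 < ∑ i, ∑ j, u i * k3Gram i j * u j

/-- `[γ]_* y = fst_* (snd^* y ∪ γ) ∈ H²(S(ℂ); ℂ)` for `γ ∈ H⁴((S × S′)(ℂ); ℂ)`, `y ∈ H²(S′(ℂ); ℂ)` — literally
the expression in the conclusion of the route items (shape `Corr[μ, S, S', hS, hS' ; γ, y]`). -/
def corr (μ : OrientationFamily) (S S' : SchemeOver ℂ) (hS : K3 S) (hS' : K3 S')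
    (γ : complexBetti (S ⊗ S') (2 * 2)) (y : complexBetti S' (2 * 1)) : complexBetti S (2 * 1) :=
  complexGysin μ (IsSmoothProjective.tensor_holds hS.1 hS'.1) hS.1
    (SemiCartesianMonoidalCategory.fst S S') (rfl : 2 * 1 + 2 * 2 + 2 * 2 = 2 * 1 + 2 * (2 + 2))
    (cupProduct (rfl : 2 * 1 + 2 * 2 = 2 * 1 + 2 * 2)
      (complexBetti.map (SemiCartesianMonoidalCategory.snd S S') (2 * 1) y) γ)

/-- Endomorphism of `Λ_ℂ` defined over `ℚ`. -/
def IsRatEnd (M : Module.End ℂ (K3Index → ℂ)) : Prop :=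
  ∀ v : K3Index → ℤ, ∃ w : K3Index → ℚ, M (fun i => (v i : ℂ)) = fun i => (w i : ℂ)

/-- A rational `2`-similitude `M` of `(Λ_ℂ, k3Form)` with rational two-sided inverse `N` — the five
conjuncts of the typed crux before the twin transport. -/
def IsTwoSimilitudePair (M N : Module.End ℂ (K3Index → ℂ)) : Prop :=
  IsRatEnd M ∧ IsRatEnd N ∧ M * N = 1 ∧ N * M = 1 ∧ ∀ a b, k3Form (M a) (M b) = 2 * k3Form a b

/-- "The twin similitude `η⁻¹ ∘ M ∘ η'` of the marked pair is induced by an algebraic class on `S × S′`." -/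
def TwinAlg (M : Module.End ℂ (K3Index → ℂ)) (μ : OrientationFamily) (S S' : SchemeOver ℂ)
    (hS : K3 S) (hS' : K3 S') (η : complexBetti S (2 * 1) ≃ₗ[ℂ] (K3Index → ℂ))
    (η' : complexBetti S' (2 * 1) ≃ₗ[ℂ] (K3Index → ℂ)) : Prop :=
  ∃ γ ∈ algebraicClasses (S ⊗ S') 2, ∀ y : complexBetti S' (2 * 1),
    η.symm (M (η' y)) = corr μ S S' hS hS' γ y

/-- **Twin transport AT the period `y`** (all markings): for every marked projective pair
`(S, η, p, y)`, `(S′, η′, p′, x′)` with `M x′ ∈ ℂy`, the twin similitude is algebraic.  The typed crux is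
`∃ M N, IsTwoSimilitudePair M N ∧ ∀ y, TTAt M y` with the binders reshuffled. -/
def TTAt (M : Module.End ℂ (K3Index → ℂ)) (y : K3Index → ℂ) : Prop :=
  ∀ (μ : OrientationFamily), μ.HasPoincareDuality →
    ∀ (S S' : SchemeOver ℂ) (hS : K3 S) (hS' : K3 S')
      (η : complexBetti S (2 * 1) ≃ₗ[ℂ] (K3Index → ℂ)) (p : complexBetti S (2 * 2))
      (η' : complexBetti S' (2 * 1) ≃ₗ[ℂ] (K3Index → ℂ)) (p' : complexBetti S' (2 * 2))
      (x' : K3Index → ℂ),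
      Marked S η p y → PeriodPt y → Marked S' η' p' x' → PeriodPt x' → (∃ t : ℂ, M x' = t • y) →
        TwinAlg M μ S S' hS hS' η η'

/-- **Twin transport at ONE marked pair at the period `y`** (the currency of the endpoint and spreading
stubs; upgraded to `TTAt` by `MarkingTransfer`). -/
def TT1At (M : Module.End ℂ (K3Index → ℂ)) (y : K3Index → ℂ) : Prop :=
  ∀ (μ : OrientationFamily), μ.HasPoincareDuality →
    ∃ (S S' : SchemeOver ℂ) (hS : K3 S) (hS' : K3 S')
      (η : complexBetti S (2 * 1) ≃ₗ[ℂ] (K3Index → ℂ)) (p : complexBetti S (2 * 2))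
      (η' : complexBetti S' (2 * 1) ≃ₗ[ℂ] (K3Index → ℂ)) (p' : complexBetti S' (2 * 2))
      (x' : K3Index → ℂ),
      Marked S η p y ∧ PeriodPt y ∧ Marked S' η' p' x' ∧ PeriodPt x' ∧ (∃ t : ℂ, M x' = t • y) ∧
        TwinAlg M μ S S' hS hS' η η'

/-- **Bundle carrier at the period `y`** — the typed OUTPUT of the instanton mechanism at a projective
fibre: a marked projective pair `(S, S′)` at `(y, x′)` with `M x′ ∈ ℂy`, a Hodge model `A` of the fourfold
`S × S′`, a class `c = ch₂(V)` of a HOLOMORPHIC VECTOR BUNDLE `V` on `(S × S′)^an`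
(`A.holomorphicBundleChernCharacter 2`; in the line: `V = 𝓔|_{X_y × F_y}`, the universal family of the
modular twin surface `F_y ⊂ M^{lf,st}_{X_y}(v)`), and `λ ≠ 0` with `[c]_* z ≡ λ·η⁻¹Mη′ z (mod NS(S))` for
all transcendental `z ∈ T(S′) = NS(S′)^⊥` (tested against transcendental `w ∈ T(S)`; `NS = N¹H²`). -/
def BundleCarrierAt (M : Module.End ℂ (K3Index → ℂ)) (y : K3Index → ℂ) : Prop :=
  ∀ (μ : OrientationFamily), μ.HasPoincareDuality →
    ∃ (S S' : SchemeOver ℂ) (hS : K3 S) (hS' : K3 S')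
      (η : complexBetti S (2 * 1) ≃ₗ[ℂ] (K3Index → ℂ)) (p : complexBetti S (2 * 2))
      (η' : complexBetti S' (2 * 1) ≃ₗ[ℂ] (K3Index → ℂ)) (p' : complexBetti S' (2 * 2))
      (x' : K3Index → ℂ),
      Marked S η p y ∧ PeriodPt y ∧ Marked S' η' p' x' ∧ PeriodPt x' ∧ (∃ t : ℂ, M x' = t • y) ∧
      ∃ (A : HodgeModel (2 + 2) (S ⊗ S')) (c : complexBetti (S ⊗ S') (2 * 2)),
        c ∈ A.holomorphicBundleChernCharacter 2 ∧
        ∃ l : ℂ, l ≠ 0 ∧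
          ∀ z : complexBetti S' (2 * 1),
            (∀ d ∈ algebraicClasses S' 1, cupProduct (rfl : 2 * 1 + 2 * 1 = 2 * 2) z d = 0) →
            ∀ w : complexBetti S (2 * 1),
              (∀ d ∈ algebraicClasses S 1, cupProduct (rfl : 2 * 1 + 2 * 1 = 2 * 2) w d = 0) →
              cupProduct (rfl : 2 * 1 + 2 * 1 = 2 * 2) (corr μ S S' hS hS' c z) w =
                cupProduct (rfl : 2 * 1 + 2 * 1 = 2 * 2) (l • η.symm (M (η' z))) w

/-! ### Period-domain geometry (`Λ_ℝ = K3Index → ℝ`, real form = `Matrix.toBilin' k3Gram` as in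
`K3TwistorLines`; same formulas as `IdeatorOneSketch.reachAxis/reachPoint`) -/

/-- Real part of a period vector. -/
def reV (σ : K3Index → ℂ) : K3Index → ℝ := fun i => (σ i).re
/-- Imaginary part of a period vector. -/
def imV (σ : K3Index → ℂ) : K3Index → ℝ := fun i => (σ i).im
/-- The real K3 form `(u.w) = Σ uᵢ Λᵢⱼ wⱼ`. -/
def rform (u w : K3Index → ℝ) : ℝ := Matrix.toBilin' (k3Gram.map (Int.cast : ℤ → ℝ)) u w
/-- A lattice vector as a real vector. -/
def castZ (h : K3Index → ℤ) : K3Index → ℝ := fun i => (h i : ℝ)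
/-- A lattice vector as a complex vector. -/
def ofZ (h : K3Index → ℤ) : K3Index → ℂ := fun i => (h i : ℂ)
/-- The three-space `⟨Re σ, Im σ, ω⟩` of the twistor line of the K3 at `σ` with Kähler direction `ω`. -/
def lineSpace (σ : K3Index → ℂ) (ω : K3Index → ℝ) : Submodule ℝ (K3Index → ℝ) :=
  Submodule.span ℝ {reV σ, imV σ, ω}
/-- Kähler-type directions at `σ`: real classes orthogonal to the period plane with positive square
(the positive cone of `H^{1,1}_ℝ`; for `NS = 0` this IS the Kähler cone, Huybrechts Ch. 7 Prop 3.7). -/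
def kaehlerDirections (σ : K3Index → ℂ) : Set (K3Index → ℝ) :=
  {ω | rform ω (reV σ) = 0 ∧ rform ω (imV σ) = 0 ∧ 0 < rform ω ω}
/-- The reach axis `u₀ = (Im σ.h) Re σ − (Re σ.h) Im σ ∈ P_σ ∩ h^⊥`. -/
def reachAxis (σ : K3Index → ℂ) (h : K3Index → ℤ) : K3Index → ℝ :=
  rform (imV σ) (castZ h) • reV σ - rform (reV σ) (castZ h) • imV σ
/-- The reach quadric `Q_h(σ) = {v ⊥ u₀, v ⊥ h, v² = u₀², ⟨Re σ, Im σ, v⟩ positive}` (TRIAGE-r1-3 F-E: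
`v ↦ u₀ + iv` maps it onto the maximal totally real `R_h(σ) ⊂ D ∩ h^⊥`). -/
def reachQuadric (σ : K3Index → ℂ) (h : K3Index → ℤ) : Set (K3Index → ℝ) :=
  {v | rform (reachAxis σ h) v = 0 ∧ rform (castZ h) v = 0 ∧
    rform v v = rform (reachAxis σ h) (reachAxis σ h) ∧ IsPositiveThreeSpace (lineSpace σ v)}
/-- The reached period `x_v = u₀ + i v`. -/
def reachPoint (σ : K3Index → ℂ) (h : K3Index → ℤ) (v : K3Index → ℝ) : K3Index → ℂ :=
  fun i => ((reachAxis σ h i : ℝ) : ℂ) + ((v i : ℝ) : ℂ) * Complex.I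

/-! ## The crux, typed — LOCAL MIRROR (verbatim the signature recorded on stmt-HodgeConjecture-14522 by
`ledger workitem set-signature`, fully qualified exactly as the gate will render it into the route file as
`Summit.HodgeConjecture.HodgeConjecture.Theses.NikulinTwinTransport.TwinTwistorTransport`; until that
render exists (the item is momentarily rendered as a `-- TODO` line, see the module docstring) the
skeleton concludes THIS decl by name, and switching to the route decl is a one-word edit of the result
types of `TwinTwistorTransport_of` / `_skeleton` below) -/

/-- **`TwinTwistorTransportTyped`** — the typed crux K2 (= payload.signature of stmt-HodgeConjecture-14522,
character for character): a rational `2`-similitude `M` of the K3 lattice with rational inverse `N` whose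
twin similitude `η⁻¹ ∘ M ∘ η′` is algebraic on EVERY marked projective `M`-twin pair. -/
def TwinTwistorTransportTyped : Prop :=
  ∃ (M N : Module.End ℂ (Literature.AlgebraicGeometry.Surfaces.K3Index → ℂ)), (∀ v : Literature.AlgebraicGeometry.Surfaces.K3Index → ℤ, ∃ w : Literature.AlgebraicGeometry.Surfaces.K3Index → ℚ, M (fun i => (v i : ℂ)) = fun i => (w i : ℂ)) ∧ (∀ v : Literature.AlgebraicGeometry.Surfaces.K3Index → ℤ, ∃ w : Literature.AlgebraicGeometry.Surfaces.K3Index → ℚ, N (fun i => (v i : ℂ)) = fun i => (w i : ℂ)) ∧ M * N = 1 ∧ N * M = 1 ∧ (∀ a b, Literature.AlgebraicGeometry.Surfaces.k3Form (M a) (M b) = 2 * Literature.AlgebraicGeometry.Surfaces.k3Form a b) ∧ ∀ (μ : Literature.AlgebraicGeometry.HodgeTheory.OrientationFamily), μ.HasPoincareDuality → ∀ (S S' : Literature.AlgebraicGeometry.Motives.SchemeOver ℂ) (hS : (Literature.AlgebraicGeometry.Motives.IsSmoothProjective 2 S ∧ Subsingleton (Literature.AlgebraicGeometry.Motives.structureSheafCohomology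 S.left 1) ∧ ∃ (A : Literature.AlgebraicGeometry.HodgeTheory.HodgeModel 2 S) (η : Literature.Geometry.Kaehler.MForm 𝓘(ℝ, A.model) A.carrier ℂ 2), Literature.Geometry.Kaehler.IsHolomorphicInCharts η ∧ ∀ x, η x ≠ 0)) (hS' : (Literature.AlgebraicGeometry.Motives.IsSmoothProjective 2 S' ∧ Subsingleton (Literature.AlgebraicGeometry.Motives.structureSheafCohomology S'.left 1) ∧ ∃ (A : Literature.AlgebraicGeometry.HodgeTheory.HodgeModel 2 S') (η : Literature.Geometry.Kaehler.MForm 𝓘(ℝ, A.model) A.carrier ℂ 2), Literature.Geometry.Kaehler.IsHolomorphicInCharts η ∧ ∀ x, η x ≠ 0)) (η : Literature.AlgebraicGeometry.HodgeTheory.complexBetti S (2 * 1) ≃ₗ[ℂ] (Literature.AlgebraicGeometry.Surfaces.K3Index → ℂ)) (p : Literature.AlgebraicGeometry.HodgeTheory.complexBetti S (2 * 2)) (x : Literature.AlgebraicGeometry.Surfaces.K3Index → ℂ) (η' : Literature.AlgebraicGeometry.HodgeTheory.complexBetti S' (2 * 1) ≃ₗ[ℂ] (Literature.AlgebraicGeometry.Surfaces.K3Index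 → ℂ)) (p' : Literature.AlgebraicGeometry.HodgeTheory.complexBetti S' (2 * 2)) (x' : Literature.AlgebraicGeometry.Surfaces.K3Index → ℂ), (Literature.AlgebraicGeometry.HodgeTheory.IsIntegralClass p ∧ (∀ q : Literature.AlgebraicGeometry.HodgeTheory.complexBetti S (2 * 2), Literature.AlgebraicGeometry.HodgeTheory.IsIntegralClass q → ∃ n : ℤ, q = n • p) ∧ (∀ c : Literature.AlgebraicGeometry.HodgeTheory.complexBetti S (2 * 1), Literature.AlgebraicGeometry.HodgeTheory.IsIntegralClass c ↔ ∃ v : Literature.AlgebraicGeometry.Surfaces.K3Index → ℤ, η c = fun i => (v i : ℂ)) ∧ (∀ a b : Literature.AlgebraicGeometry.HodgeTheory.complexBetti S (2 * 1), Literature.AlgebraicTopology.SingularHomology.cupProduct (rfl : 2 * 1 + 2 * 1 = 2 * 2) a b = Literature.AlgebraicGeometry.Surfaces.k3Form (η a) (η b) • p) ∧ Literature.AlgebraicGeometry.HodgeTheory.IsOfHodgeType 2 S (2 * 1) 2 0 (η.symm x) ∧ (∀ τ : Literature.AlgebraicGeometry.HodgeTheory.complexBetti S (2 * 1), Literature.AlgebraicGeometry.HodgeTheory.IsOfHodgeType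 2 S (2 * 1) 2 0 τ → ∃ t : ℂ, τ = t • η.symm x)) → (Literature.AlgebraicGeometry.Surfaces.k3Form x x = 0 ∧ 0 < (Literature.AlgebraicGeometry.Surfaces.k3Form (star x) x).re ∧ ∃ u : Literature.AlgebraicGeometry.Surfaces.K3Index → ℤ, Literature.AlgebraicGeometry.Surfaces.k3Form (fun i => (u i : ℂ)) x = 0 ∧ 0 < ∑ i, ∑ j, u i * Literature.AlgebraicGeometry.Surfaces.k3Gram i j * u j) → (Literature.AlgebraicGeometry.HodgeTheory.IsIntegralClass p' ∧ (∀ q : Literature.AlgebraicGeometry.HodgeTheory.complexBetti S' (2 * 2), Literature.AlgebraicGeometry.HodgeTheory.IsIntegralClass q → ∃ n : ℤ, q = n • p') ∧ (∀ c : Literature.AlgebraicGeometry.HodgeTheory.complexBetti S' (2 * 1), Literature.AlgebraicGeometry.HodgeTheory.IsIntegralClass c ↔ ∃ v : Literature.AlgebraicGeometry.Surfaces.K3Index → ℤ, η' c = fun i => (v i : ℂ)) ∧ (∀ a b : Literature.AlgebraicGeometry.HodgeTheory.complexBetti S' (2 * 1), Literature.AlgebraicTopology.SingularHomology.cupProduct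 (rfl : 2 * 1 + 2 * 1 = 2 * 2) a b = Literature.AlgebraicGeometry.Surfaces.k3Form (η' a) (η' b) • p') ∧ Literature.AlgebraicGeometry.HodgeTheory.IsOfHodgeType 2 S' (2 * 1) 2 0 (η'.symm x') ∧ (∀ τ : Literature.AlgebraicGeometry.HodgeTheory.complexBetti S' (2 * 1), Literature.AlgebraicGeometry.HodgeTheory.IsOfHodgeType 2 S' (2 * 1) 2 0 τ → ∃ t : ℂ, τ = t • η'.symm x')) → (Literature.AlgebraicGeometry.Surfaces.k3Form x' x' = 0 ∧ 0 < (Literature.AlgebraicGeometry.Surfaces.k3Form (star x') x').re ∧ ∃ u : Literature.AlgebraicGeometry.Surfaces.K3Index → ℤ, Literature.AlgebraicGeometry.Surfaces.k3Form (fun i => (u i : ℂ)) x' = 0 ∧ 0 < ∑ i, ∑ j, u i * Literature.AlgebraicGeometry.Surfaces.k3Gram i j * u j) → (∃ t : ℂ, M x' = t • x) → ∃ γ ∈ Literature.AlgebraicGeometry.HodgeTheory.algebraicClasses (CategoryTheory.MonoidalCategoryStruct.tensorObj S S') 2, ∀ y : Literature.AlgebraicGeometry.HodgeTheory.complexBetti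 S' (2 * 1), η.symm (M (η' y)) = Literature.AlgebraicGeometry.HodgeTheory.complexGysin μ (Literature.AlgebraicGeometry.Motives.IsSmoothProjective.tensor_holds hS.1 hS'.1) hS.1 (CategoryTheory.SemiCartesianMonoidalCategory.fst S S') (rfl : 2 * 1 + 2 * 2 + 2 * 2 = 2 * 1 + 2 * (2 + 2)) (Literature.AlgebraicTopology.SingularHomology.cupProduct (rfl : 2 * 1 + 2 * 2 = 2 * 1 + 2 * 2) (Literature.AlgebraicGeometry.HodgeTheory.complexBetti.map (CategoryTheory.SemiCartesianMonoidalCategory.snd S S') (2 * 1) y) γ)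

/-! ## The stub statements (precise `Prop`s, taken BY NAME as the hypotheses of
`TwinTwistorTransport_of`; their sorried witnesses `Stub.<Name>` below are the REGISTERED stubs — the
skeleton audit matches a hypothesis head to a declared stub by its last name component) -/

/-- **Stub A · AnchoredLineCarriers** (THE LEVER — anchor + trianalytic transport + Chow endpoint of the
instanton line, read at the projective fibres of ONE twistor line per Kähler direction; XL; hardest;
formal proof blocked on definitions D1–D3).  There are a rational `2`-similitude pair `(M, N)` and, for
every lattice vector `h` with `h² > 0`, an anchor period `σ₀ ∈ D` with `(h.σ₀) ≠ 0` and a non-empty open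
set `C` of Kähler directions at `σ₀` such that every point `y ⊥ h` of every twistor line
`T_{⟨Re σ₀, Im σ₀, ω⟩}`, `ω ∈ C`, carries a bundle carrier for `M`.  WHY PLAUSIBLE: it follows from HC
(graph of the twin similitude algebraic ⇒ a resolution of the graph cycle has a summand with non-zero
transcendental `ch₂`); the line proves it WITHOUT HC by the instanton mechanism (card; Verbitsky
alg-geom/9307008 Thm 6.3/Cor 10.1/Prop 11.2, Itoh 1988/Nakajima `L²` metric, Kaledin–Verbitsky for
modular carriers, Buskin2019 §5, Chow + GAGA + quasi-universal families, Mukai 1987/O'Grady 1997).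
WHY IT MIGHT FAIL: existence of the modular anchor family (crux 14464 in instanton form: a compact
trianalytic `Y′ ≅ F ⊂ M^{lf,st}_X(r,0,s)`, `s ≤ −r`, `m > 0` even) — every concrete carrier on record is
dead (sibling Disproof verdict), the bare existential survives. [deps: stmt-HodgeConjecture-14464] -/
def AnchoredLineCarriers : Prop :=
  ∃ M N : Module.End ℂ (K3Index → ℂ), IsTwoSimilitudePair M N ∧
    ∀ h : K3Index → ℤ, 0 < ∑ i, ∑ j, h i * k3Gram i j * h j →
      ∃ σ ∈ k3PeriodDomain, k3Form (ofZ h) σ ≠ 0 ∧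
        ∃ C : Set (K3Index → ℝ), IsOpen C ∧ C.Nonempty ∧ C ⊆ kaehlerDirections σ ∧
          ∀ ω ∈ C, ∀ y ∈ k3TwistorLine (lineSpace σ ω), k3Form (ofZ h) y = 0 → BundleCarrierAt M y

/-- **Stub B · Reach** (one-line REACH, M, PROVABLE NOW; TRIAGE-r1-3 F-E checked it line by line).  For
`σ ∈ D`, `h² > 0`, `(h.σ) ≠ 0` and a non-empty open `C ⊆ kaehlerDirections σ`: there is an open `U` with
`U ∩ Q_h(σ) ≠ ∅` such that for every `v ∈ U ∩ Q_h(σ)` some `ω ∈ C` has both `u₀ + iv` and `u₀ − iv` on the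
twistor line `T_{⟨Re σ, Im σ, ω⟩}`, and both are `⊥ h`.  Proof sketch: `ω ↦ v(ω) ∝ (ω.h)u₀′ − (u₀′.h)ω`
(`u₀′ ∈ P_σ ⊥ u₀`, `(u₀′.h) ≠ 0` iff `(h.σ) ≠ 0`), normalised to `v² = u₀²`; conversely
`v ↦ v − pr_{P_σ}v` recovers the ray of `ω`, continuously, so `U := {v | b₀⁻¹(v − pr v) ∈ C}` is open;
`x_{±v} ∈ D` since `v ⊥ u₀`, `v² = u₀² > 0`.  WHY IT MIGHT FAIL: only by a slip in the normalisations
(sign of `b`, `u₀ = 0` when `h ⊥ P_σ` — excluded by `(h.σ) ≠ 0`). [Huybrechts2016K3 Ch. 6 §1, Ch. 7 §3.1] -/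
def Reach : Prop :=
  ∀ σ ∈ k3PeriodDomain, ∀ h : K3Index → ℤ, 0 < ∑ i, ∑ j, h i * k3Gram i j * h j →
    k3Form (ofZ h) σ ≠ 0 →
    ∀ C : Set (K3Index → ℝ), IsOpen C → C.Nonempty → C ⊆ kaehlerDirections σ →
      ∃ U : Set (K3Index → ℝ), IsOpen U ∧ (U ∩ reachQuadric σ h).Nonempty ∧
        ∀ v ∈ U ∩ reachQuadric σ h, ∃ ω ∈ C,
          reachPoint σ h v ∈ k3TwistorLine (lineSpace σ ω) ∧
          reachPoint σ h (-v) ∈ k3TwistorLine (lineSpace σ ω) ∧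
          k3Form (ofZ h) (reachPoint σ h v) = 0 ∧ k3Form (ofZ h) (reachPoint σ h (-v)) = 0

/-- **Stub D · Spread** (SPREADING PRINCIPLE, L–XL).  Granted the composition of correspondences (stub E,
stated inline): if for a rational 2-similitude pair `(M, N)`, `σ ∈ D`,
`h² > 0`, `(h.σ) ≠ 0`, twin transport holds at one marked pair at `u₀ + iv` and at `u₀ − iv` for all `v`
in a non-empty relatively open subset of the reach quadric `Q_h(σ)`, then it holds at one marked pair at
EVERY `y ∈ D ∩ h^⊥`.  WHY PLAUSIBLE: `{u₀ + iv : v ∈ Q_h(σ)}` is a maximal totally real real-analytic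
submanifold of each sheet of `D_h = D ∩ h^⊥` (F-E), the twin-transport locus in `D_h` is a countable
union of closed analytic subsets (pull-back of images of proper relative Hilbert schemes over the
algebraic Hecke correspondence `Γ_h\D_h ↔ Γ_{h′}\D_{h′}`, `h′ ∝ N h`; Baily–Borel), and a closed analytic
set containing an open piece of a maximal totally real submanifold has interior (identity principle),
hence is the whole sheet; Baire picks the member; markings are compared through Buskin's theorem (named
fact `Buskin2019_hodgeIsometry_algebraic`, = route item r2 — a stub prover is `blocked-on` it until it is
discharged) + CorrComp.
WHY IT MIGHT FAIL: the algebraicity of the Hecke twin correspondence for a RATIONAL (not integral) `M`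
must be checked (commensurability of `N Γ_h N⁻¹` with `Γ_{h′}`), and points of `D_h` on `(−2)`-walls have
no ample-marked model — harmless for `TT1At` (any projective marked model will do).
[VoisinHodgeII2003 Ch. 5 (Hodge loci); CattaniDeligneKaplan1995; Huybrechts2016K3 Ch. 6 §4; Buskin2019 §6] -/
def Spread : Prop :=
  (∀ (μ : OrientationFamily), μ.HasPoincareDuality →
      ∀ (S S' S'' : SchemeOver ℂ) (hS : K3 S) (hS' : K3 S') (hS'' : K3 S''),
      ∀ γ ∈ algebraicClasses (S ⊗ S') 2, ∀ γ' ∈ algebraicClasses (S' ⊗ S'') 2,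
      ∃ γ'' ∈ algebraicClasses (S ⊗ S'') 2, ∀ y : complexBetti S'' (2 * 1),
        corr μ S S'' hS hS'' γ'' y = corr μ S S' hS hS' γ (corr μ S' S'' hS' hS'' γ' y)) →
    ∀ M N : Module.End ℂ (K3Index → ℂ), IsTwoSimilitudePair M N →
    ∀ σ ∈ k3PeriodDomain, ∀ h : K3Index → ℤ, 0 < ∑ i, ∑ j, h i * k3Gram i j * h j →
      k3Form (ofZ h) σ ≠ 0 →
      ∀ U : Set (K3Index → ℝ), IsOpen U → (U ∩ reachQuadric σ h).Nonempty →
        (∀ v ∈ U ∩ reachQuadric σ h, TT1At M (reachPoint σ h v) ∧ TT1At M (reachPoint σ h (-v))) →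
        ∀ y ∈ k3PeriodDomain, k3Form (ofZ h) y = 0 → TT1At M y

/-- **Stub C · Endpoint** (ENDPOINT READING, L).  A bundle carrier at `y` gives twin transport at one
marked pair at `y`.  Proof sketch: `c = ch₂(V)` is
algebraic (Voisin I Thm 11.32 ⊗ ℂ = named fact `span_holomorphicBundleChernCharacter_eq_algebraicClasses`,
the projective case — NOT the Kähler case of barrier `Voisin2002_weilTorus…`); `E := [c]_* − λ·η⁻¹Mη′`
is a morphism of rational Hodge structures `H²(S′) → H²(S)` (`c` algebraic; the twin similitude is
rational and type-preserving, `isOfHodgeType_markingConj`) with `E(T(S′)) ⊆ T(S)^⊥ = NS(S)_ℂ`, so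
`E|_{T(S′)} = 0` (`T_ℚ` irreducible, Huybrechts Ch. 3 Lemma 3.1) and `E(NS(S′)) ⊆ NS(S)` (Lefschetz (1,1),
named fact `lefschetzOneOne_rational` = route item `LefschetzOneOneK3`):
`E = [Σ Dᵢ × D′ⱼ]_*` is induced by products of divisors, algebraic (`AlgebraicClassesExteriorProduct`);
hence `λ·twin = [c − Σ…]_*` and `λ ≠ 0`.  WHY IT MIGHT FAIL: only the bookkeeping of the comparison
scalars of `A.deRham` (junk analysis of `HolomorphicBundleChernCharacter`) and of `[D × D′]_*`.
[VoisinHodgeI2002 Thm 11.32; Huybrechts2016K3 Ch. 3 §3; Fulton1998 §16.1] -/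
def Endpoint : Prop :=
  ∀ M N : Module.End ℂ (K3Index → ℂ), IsTwoSimilitudePair M N →
    ∀ y : K3Index → ℂ, BundleCarrierAt M y → TT1At M y

/-- **Stub E · CorrComp** (composition of algebraic correspondences between K3 surfaces, L; formal debt
named by the route for `RealMultiplicationGlue`, and symbol for symbol the hypothesis `hcomp` of
`twinSimilitudeAlgebraic_of_twinTransport`): for algebraic `γ ∈ N²H⁴(S × S′)`, `γ′ ∈ N²H⁴(S′ × S″)` there
is an algebraic `γ″ ∈ N²H⁴(S × S″)` with `[γ″]_* = [γ]_* ∘ [γ′]_*` on `H²(S″(ℂ); ℂ)`.  WHY IT MIGHT FAIL: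
needs Gysin base change for product squares and the moving-lemma input on the tree's real carriers
(neither in the tree yet; in print `γ″ = p₁₃*(p₁₂^*γ · p₂₃^*γ′)`). [Fulton1998 Prop 16.1.1; Buskin2019 Lemma 6.3] -/
def CorrComp : Prop :=
  ∀ (μ : OrientationFamily), μ.HasPoincareDuality →
    ∀ (S S' S'' : SchemeOver ℂ) (hS : K3 S) (hS' : K3 S') (hS'' : K3 S''),
    ∀ γ ∈ algebraicClasses (S ⊗ S') 2, ∀ γ' ∈ algebraicClasses (S' ⊗ S'') 2,
    ∃ γ'' ∈ algebraicClasses (S ⊗ S'') 2, ∀ y : complexBetti S'' (2 * 1),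
      corr μ S S'' hS hS'' γ'' y = corr μ S S' hS hS' γ (corr μ S' S'' hS' hS'' γ' y)

/-- **Stub F · MarkingTransfer** (M modulo Buskin).  Granted stub E (inline): twin transport at ONE marked
pair at `y` gives it at EVERY marked pair at `y`.  Proof sketch: for another pair
`(S₁, η₁), (S₁′, η₁′)` at `(y, x₁′)`, `η₁⁻¹Mη₁′ = (η₁⁻¹η) ∘ (η⁻¹Mη′) ∘ (η′⁻¹η₁′)` and the outer factors are
rational Hodge ISOMETRIES between projective K3 surfaces (same period lines: `x₁′ ∈ ℂx′` because
`M x₁′, M x′ ∈ ℂy` and `M` is injective; `isRationalClass_markingConj`, `isOfHodgeType_markingConj`,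
`cupProduct_markingConj` with multiplier `1`), algebraic by Buskin's theorem (named fact
`Buskin2019_hodgeIsometry_algebraic`); compose twice.  WHY IT MIGHT FAIL:
only the sign of the generators `p` vs `p₁` (handled as in `twinSimilitudeAlgebraic_of_twinTransport`,
`not_antiIsometry_k3Form`). [Buskin2019 Thm 1.1, §6.2; Huybrechts2016K3 Ch. 6 Rem 3.3] -/
def MarkingTransfer : Prop :=
  (∀ (μ : OrientationFamily), μ.HasPoincareDuality →
      ∀ (S S' S'' : SchemeOver ℂ) (hS : K3 S) (hS' : K3 S') (hS'' : K3 S''),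
      ∀ γ ∈ algebraicClasses (S ⊗ S') 2, ∀ γ' ∈ algebraicClasses (S' ⊗ S'') 2,
      ∃ γ'' ∈ algebraicClasses (S ⊗ S'') 2, ∀ y : complexBetti S'' (2 * 1),
        corr μ S S'' hS hS'' γ'' y = corr μ S S' hS hS' γ (corr μ S' S'' hS' hS'' γ' y)) →
    ∀ M N : Module.End ℂ (K3Index → ℂ), IsTwoSimilitudePair M N →
      ∀ y : K3Index → ℂ, TT1At M y → TTAt M y

/-! ## Registered stubs `Stub.<Name>` (`sorry` lives only here; signatures = the statements verbatim,
unfolded one level, over the vocabulary `def`s above — a `--supports stmt-HodgeConjecture-14522` proof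
restates them after `import`ing this module or copying the vocabulary block) -/

namespace Stub

/-- Stub A, registered form (statement verbatim = def `AnchoredLineCarriers`). -/
theorem AnchoredLineCarriers : ∃ M N : Module.End ℂ (K3Index → ℂ), IsTwoSimilitudePair M N ∧ ∀ h : K3Index → ℤ, 0 < ∑ i, ∑ j, h i * k3Gram i j * h j → ∃ σ ∈ k3PeriodDomain, k3Form (ofZ h) σ ≠ 0 ∧ ∃ C : Set (K3Index → ℝ), IsOpen C ∧ C.Nonempty ∧ C ⊆ kaehlerDirections σ ∧ ∀ ω ∈ C, ∀ y ∈ k3TwistorLine (lineSpace σ ω), k3Form (ofZ h) y = 0 → BundleCarrierAt M y := by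
  sorry

/-- Stub B, registered form (statement verbatim = def `Reach`). -/
theorem Reach : ∀ σ ∈ k3PeriodDomain, ∀ h : K3Index → ℤ, 0 < ∑ i, ∑ j, h i * k3Gram i j * h j → k3Form (ofZ h) σ ≠ 0 → ∀ C : Set (K3Index → ℝ), IsOpen C → C.Nonempty → C ⊆ kaehlerDirections σ → ∃ U : Set (K3Index → ℝ), IsOpen U ∧ (U ∩ reachQuadric σ h).Nonempty ∧ ∀ v ∈ U ∩ reachQuadric σ h, ∃ ω ∈ C, reachPoint σ h v ∈ k3TwistorLine (lineSpace σ ω) ∧ reachPoint σ h (-v) ∈ k3TwistorLine (lineSpace σ ω) ∧ k3Form (ofZ h) (reachPoint σ h v) = 0 ∧ k3Form (ofZ h) (reachPoint σ h (-v)) = 0 := by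
  sorry

/-- Stub D, registered form (statement verbatim = def `Spread`). -/
theorem Spread : (∀ (μ : OrientationFamily), μ.HasPoincareDuality → ∀ (S S' S'' : SchemeOver ℂ) (hS : K3 S) (hS' : K3 S') (hS'' : K3 S''), ∀ γ ∈ algebraicClasses (S ⊗ S') 2, ∀ γ' ∈ algebraicClasses (S' ⊗ S'') 2, ∃ γ'' ∈ algebraicClasses (S ⊗ S'') 2, ∀ y : complexBetti S'' (2 * 1), corr μ S S'' hS hS'' γ'' y = corr μ S S' hS hS' γ (corr μ S' S'' hS' hS'' γ' y)) → ∀ M N : Module.End ℂ (K3Index → ℂ), IsTwoSimilitudePair M N → ∀ σ ∈ k3PeriodDomain, ∀ h : K3Index → ℤ, 0 < ∑ i, ∑ j, h i * k3Gram i j * h j → k3Form (ofZ h) σ ≠ 0 → ∀ U : Set (K3Index → ℝ), IsOpen U → (U ∩ reachQuadric σ h).Nonempty → (∀ v ∈ U ∩ reachQuadric σ h, TT1At M (reachPoint σ h v) ∧ TT1At M (reachPoint σ h (-v))) → ∀ y ∈ k3PeriodDomain, k3Form (ofZ h) y = 0 → TT1At M y := by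
  sorry

/-- Stub C, registered form (statement verbatim = def `Endpoint`). -/
theorem Endpoint : ∀ M N : Module.End ℂ (K3Index → ℂ), IsTwoSimilitudePair M N → ∀ y : K3Index → ℂ, BundleCarrierAt M y → TT1At M y := by
  sorry

/-- Stub E, registered form (statement verbatim = def `CorrComp`). -/
theorem CorrComp : ∀ (μ : OrientationFamily), μ.HasPoincareDuality → ∀ (S S' S'' : SchemeOver ℂ) (hS : K3 S) (hS' : K3 S') (hS'' : K3 S''), ∀ γ ∈ algebraicClasses (S ⊗ S') 2, ∀ γ' ∈ algebraicClasses (S' ⊗ S'') 2, ∃ γ'' ∈ algebraicClasses (S ⊗ S'') 2, ∀ y : complexBetti S'' (2 * 1), corr μ S S'' hS hS'' γ'' y = corr μ S S' hS hS' γ (corr μ S' S'' hS' hS'' γ' y) := by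
  sorry

/-- Stub F, registered form (statement verbatim = def `MarkingTransfer`). -/
theorem MarkingTransfer : (∀ (μ : OrientationFamily), μ.HasPoincareDuality → ∀ (S S' S'' : SchemeOver ℂ) (hS : K3 S) (hS' : K3 S') (hS'' : K3 S''), ∀ γ ∈ algebraicClasses (S ⊗ S') 2, ∀ γ' ∈ algebraicClasses (S' ⊗ S'') 2, ∃ γ'' ∈ algebraicClasses (S ⊗ S'') 2, ∀ y : complexBetti S'' (2 * 1), corr μ S S'' hS hS'' γ'' y = corr μ S S' hS hS' γ (corr μ S' S'' hS' hS'' γ' y)) → ∀ M N : Module.End ℂ (K3Index → ℂ), IsTwoSimilitudePair M N → ∀ y : K3Index → ℂ, TT1At M y → TTAt M y := by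
  sorry

end Stub

/-! ## The composition (kernel-checked; concludes the typed crux `TwinTwistorTransportTyped` BY NAME — the local
mirror of the recorded signature, see above; no `sorry` below this line) -/

/-- **`TwinTwistorTransport_of`** — the glue of the line.  Given the marked pairs of the crux, take the
positive lattice vector `h := u` of `PeriodPt x`; stub A gives the anchor `σ₀` and the open set `C` of
directions; stub B the relatively open piece of the reach quadric; stubs A + C twin transport at one
marked pair at each of its points `u₀ ± iv`; stub D spreads it to `x ∈ D ∩ h^⊥`; stub F moves it to the
given markings (stub E, the composition of correspondences, feeds D and F). -/
theorem TwinTwistorTransport_of (h₁ : AnchoredLineCarriers) (h₂ : Reach) (h₃ : Spread)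
    (h₄ : Endpoint) (h₅ : CorrComp) (h₆ : MarkingTransfer) :
    TwinTwistorTransportTyped := by
  obtain ⟨M, N, hMN, hcar⟩ := h₁
  refine ⟨M, N, hMN.1, hMN.2.1, hMN.2.2.1, hMN.2.2.2.1, hMN.2.2.2.2, ?_⟩
  intro μ hμ S S' hS hS' η p x η' p' x' hm hx hm' hx' hper
  obtain ⟨u, hux, hupos⟩ := hx.2.2
  obtain ⟨σ, hσD, hσu, C, hCo, hCne, hCK, hlines⟩ := hcar u hupos
  obtain ⟨U, hUo, hUne, hreach⟩ := h₂ σ hσD u hupos hσu C hCo hCne hCK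
  have hTT1 : ∀ v ∈ U ∩ reachQuadric σ u,
      TT1At M (reachPoint σ u v) ∧ TT1At M (reachPoint σ u (-v)) := by
    intro v hv
    obtain ⟨ω, hωC, hv₁, hv₂, hv₃, hv₄⟩ := hreach v hv
    exact ⟨h₄ M N hMN _ (hlines ω hωC _ hv₁ hv₃), h₄ M N hMN _ (hlines ω hωC _ hv₂ hv₄)⟩
  have hxD : x ∈ k3PeriodDomain := ⟨hx.1, hx.2.1⟩
  have hxT : TT1At M x := h₃ h₅ M N hMN σ hσD u hupos hσu U hUo hUne hTT1 x hxD hux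
  exact h₆ h₅ M N hMN x hxT μ hμ S S' hS hS' η p η' p' x' hm hx hm' hx' hper

/-- **The skeleton**: the crux modulo exactly the six registered stubs. -/
theorem TwinTwistorTransport_skeleton : TwinTwistorTransportTyped :=
  TwinTwistorTransport_of Stub.AnchoredLineCarriers Stub.Reach Stub.Spread Stub.Endpoint
    Stub.CorrComp Stub.MarkingTransfer

/-! ## Side theorem (kernel-checked, NOT the skeleton): the typed crux decides the route's target -/

/-- **The typed crux feeds the target X = `TwinSimilitudeAlgebraic`**, through the tree's PROVED Buskin
transfer `twinSimilitudeAlgebraic_of_twinTransport`, granted Buskin (route item r2), the three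
Huybrechts K3 facts (period surjectivity, markings, Hodge types of `H²`) and the composition of
correspondences (stub E).  So `K2 typed ⟹ X` modulo exactly what the route header says
("Equivalent (Buskin + composition of correspondences) to 'graph(Ψ) is algebraic on every twin pair'"). -/
theorem twinSimilitudeAlgebraic_of_crux
    (hK2 : TwinTwistorTransportTyped) (hB : HodgeIsometryAlgebraic)
    (hP : Huybrechts_K3_periodSurjective_projective) (hM : Huybrechts_K3_marking_exists)
    (hHT : Huybrechts_K3_hodgeTypes_H2) (hcomp : CorrComp) :
    TwinSimilitudeAlgebraic := by
  obtain ⟨M, N, -, hNr, hMN, -, hM2, htw⟩ := hK2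
  exact Theorems.NikulinTwinTransport.twinSimilitudeAlgebraic_of_twinTransport hB hP hM hHT hcomp
    M N hNr hMN hM2 htw

end Summit.HodgeConjecture.HodgeConjecture.Cruxes.TwinTwistorTransport.InstantonModuliTrianalyticTwin
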